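import Summits.ResolutionOfSingularities.ResolutionOfSingularities.Theorems.MarkedTransferCampaignW46ThreadChainFollowedReach
import Summits.ResolutionOfSingularities.ResolutionOfSingularities.Theorems.MarkedTransferCampaignW46ThreadChainExceptional
import HarnessLib

/-!
# [OURS · L1 W4.6 rung (i-a)] Thread chains, IX: the followed-curve end game and THE THREAD-CHAIN THEOREM
# `not_isThreadChain` — no infinite chain of infinitely near singular points of `(J, b)` on a surface with isolated
# singular locus
# (cell res-hironaka, LADDER-RESOLUTION rung L, D-0089; campaign s46, prover res-L1-s46-pv-1; host route MarkedTransfer,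
# `--supports stmt-ResolutionOfSingularities-16155`)

HONEST FRAMING. Nothing here is a statement of H. Hironaka's manuscript (2017-03-23, [Hironaka2017]). Pure commutative
algebra inside a field `F` about the thread chains `IsThreadChain b R J` (`MarkedTransferCampaignW46ThreadChain*.lean`).
AI review is weaker than expert review. No `sorry`; axioms standard.

## Contents

* `exists_smooth_data` — **the smooth regime** (with `exists_ker_eq_span`, `maximalIdeal_eq_span_of_reach` of the
  companion `…FollowedReach.lean`): once
  `θ(R c) = θ(O)` (reach), `𝔪_c = (t, q)` with `θ(t)` a uniformizer of the discrete valuation ring `θ(O)` and `(q)` the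
  kernel of `θ_c` (the followed curve, now smooth with transversal parameter `t`), and `J c = (q^e g)`, `e < b`
  (isolated singular locus), `θ(g) ≠ 0`.
* `smooth_step` — **one step along the smooth branch**: the chain blows up along `t` (`q ∈ 𝔪_W ∌ t`),
  `𝔪_{c+1} = (t, q/t)` (`maximalIdeal_eq_span_pair`), and the transform law forces `J (c+1) = ((q/t)^e g')` with
  `g = t^{b-e} g'`.
* `false_of_smooth_data` — **descent**: `ν(θ g) = (b - e) + ν(θ g')` in the discrete valuation ring `θ(O)`, `b - e ≥ 1`,
  so the data cannot persist forever; `false_of_forall_le_localSubring`, `false_of_forall_le` — the followed-curve end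
  game for the prime divisor `(R N)_{(π)}`.
* **`not_isThreadChain b R J : ¬ IsThreadChain b R J`** — THE THREAD-CHAIN THEOREM: combined with the exceptional end game
  (`false_of_forall_exists_not_le`, `…ThreadChainExceptional.lean`), no thread chain exists. This is the local algebra of
  rung (i-a) (`CampaignW46.PlaneIsolatedNoHitThread`); the passage from a hit thread of a permissible sequence to a
  thread chain is the remaining (scheme-theoretic) bridge.

## References

* O. Zariski, P. Samuel, *Commutative Algebra* II (1960), Appendix 5 (infinitely near points). [ZariskiSamuel1960]
* M. Herrmann, S. Ikeda, U. Orbanz, *Equimultiplicity and Blowing up* (1988), proof of Thm. (30.2). [HerrmannIkedaOrbanz1988]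
* S. S. Abhyankar, Amer. J. Math. 78 (1956), Lemma 12, Thm. 3. [Abhyankar1956Valuations]
-/

noncomputable section

set_option linter.dupNamespace false -- mandated namespace of this single-conjunct summit

open IsLocalRing

namespace Summit.ResolutionOfSingularities.ResolutionOfSingularities.Theorems

namespace CampaignW46

open Literature.AlgebraicGeometry.Resolution Literature.RingTheory.DiscreteValuationRing

universe u

variable {F : Type u} [Field F]

namespace IsThreadChain

variable {b : ℕ} {R : ℕ → Subring F} {J : ∀ k, Ideal (R k)} (h : IsThreadChain b R J)
include h

section Descent

variable {O : ValuationSubring F} (hO : ∀ k, SubringDominates (R k) O.toSubring) {W : LocalSubring F} {N : ℕ}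
  (hall : ∀ k, N ≤ k → R k ≤ W.toSubring)
include hO hall

/-- **The smooth regime is reached.** Under the hypotheses of `exists_reach`, at some stage `c ≥ N`: `θ(O)` is a discrete
valuation ring, `𝔪_c = (t, q)` with `θ(t)` a uniformizer of `θ(O)` and `θ(q) = 0` (the followed curve is smooth at the
point of stage `c`, `t` a transversal parameter), and `J c = (q^e · g)` with `e < b` and `θ(g) ≠ 0`.
[cite: HerrmannIkedaOrbanz1988, Thm. (30.2) (proof)] -/
theorem exists_smooth_data
    (hfrac : ∀ w ∈ W.toSubring, ∃ a ∈ R N, ∃ s ∈ R N, s ≠ 0 ∧ s⁻¹ ∈ W.toSubring ∧ w = a * s⁻¹)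
    (hunit : ∃ z : R N, z ≠ 0 ∧ (z : F)⁻¹ ∉ R N ∧ (z : F)⁻¹ ∈ W.toSubring)
    (hnon : ∃ w : R N, w ≠ 0 ∧ (w : F)⁻¹ ∉ W.toSubring) :
    IsDiscreteValuationRing (residueImage O W (h.le_of_forall_le hO hall)) ∧
    ∃ (c : ℕ) (hc : N ≤ c) (t q g : R c) (e : ℕ),
      (haveI := (h.isRegularLocalRing c).toIsLocalRing; maximalIdeal (R c)) = Ideal.span {t, q} ∧
      residueMap W (hall c hc) q = 0 ∧
      Irreducible (⟨residueMap W (hall c hc) t, residueMap_mem_residueImage hO (h.le_of_forall_le hO hall) c t⟩ :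
        residueImage O W (h.le_of_forall_le hO hall)) ∧
      e < b ∧ J c = Ideal.span {q ^ e * g} ∧ residueMap W (hall c hc) g ≠ 0 := by
  classical
  have hOW := h.le_of_forall_le hO hall
  obtain ⟨hdvr, c₀, hc₀, hreach⟩ := h.exists_reach hO hall hfrac hunit hnon
  haveI := hdvr
  refine ⟨hdvr, ?_⟩
  obtain ⟨N₀, hN₀⟩ := h.exists_forall_isPrincipal
  have hc : N ≤ max c₀ N₀ := hc₀.trans (le_max_left _ _)
  haveI := h.isRegularLocalRing (max c₀ N₀)
  set θ := residueMap W (hall (max c₀ N₀) hc) with hθ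
  have hreach' : ∀ v ∈ residueImage O W hOW, ∃ z : R (max c₀ N₀), θ z = v := by
    intro v hv
    obtain ⟨z, hz⟩ := hreach v hv
    exact ⟨Subring.inclusion (h.mono (le_max_left _ _)) z, hz⟩
  -- a uniformizer `θ(t)`
  obtain ⟨ϖ, hϖ⟩ := IsDiscreteValuationRing.exists_irreducible (residueImage O W hOW)
  obtain ⟨t, ht⟩ := hreach' ϖ ϖ.2
  have hθt : (⟨θ t, residueMap_mem_residueImage hO hOW _ t⟩ : residueImage O W hOW) = ϖ := Subtype.ext ht
  have hϖt := hϖ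
  rw [← hθt] at hϖt
  have hθt0 : θ t ≠ 0 := fun e => hϖt.ne_zero (Subtype.ext e)
  have htnu : ¬ IsUnit t := fun hu => hϖt.not_isUnit ((h.isUnit_residueMap_iff hO hall hc t).mpr hu)
  obtain ⟨q, hqp, hq⟩ := h.exists_ker_eq_span hall hc hnon htnu hθt0
  have hm := h.maximalIdeal_eq_span_of_reach hO hall hc hreach' hqp hq hϖt
  have hθq : θ q = 0 := by rw [← RingHom.mem_ker, hq]; exact Ideal.mem_span_singleton_self q
  have hkerm : Ideal.span {q} ≠ maximalIdeal (R (max c₀ N₀)) := by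
    intro he
    have : t ∈ Ideal.span {q} := by rw [he, hm]; exact Ideal.subset_span (Set.mem_insert _ _)
    rw [← hq, RingHom.mem_ker] at this
    exact hθt0 this
  -- `J c = (q^e g)` with `q ∤ g`
  obtain ⟨u, hu⟩ := hN₀ (max c₀ N₀) (le_max_right _ _)
  have hu' : J (max c₀ N₀) = Ideal.span {u} := hu
  have hu0 : u ≠ 0 := by
    intro h0; apply h.ne_bot (max c₀ N₀); rw [hu', h0, Ideal.span_singleton_eq_bot]
  obtain ⟨e, g, hqg, hug⟩ := WfDvdMonoid.max_power_factor hu0 hqp.irreducible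
  have hθg : θ g ≠ 0 := by
    intro h0
    have : g ∈ RingHom.ker θ := h0
    rw [hq] at this
    exact hqg (Ideal.mem_span_singleton.mp this)
  have heb : e < b := by
    by_contra hge
    push Not at hge
    apply h.not_le_span_pow (max c₀ N₀) q hqp hkerm
    rw [hu', hug, Ideal.span_singleton_le_span_singleton]
    exact (pow_dvd_pow q hge).mul_right g
  exact ⟨max c₀ N₀, hc, t, q, g, e, hm, hθq, hϖt, heb, hu'.trans (by rw [hug]), hθg⟩

/-- **One step in the smooth regime.** From `𝔪_k = (t, q)`, `θ(q) = 0`, `θ(t) ≠ 0`, `J k = (q^e g)`, `e < b`, `θ(g) ≠ 0`: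
the chain blows up along `t` (`ν_O(t) < ν_O(q)` since `q ∈ 𝔪_W ∌ t`), `𝔪_{k+1} = (t, q/t)`, `θ(q/t) = 0`, and
`J (k+1) = ((q/t)^e g')` with `g = t^{b-e} g'` in `R (k+1)` — so `θ(g) = θ(t)^{b-e} θ(g')`.
[cite: ZariskiSamuel1960, Appendix 5] -/
theorem smooth_step {k : ℕ} (hk : N ≤ k) {t q g : R k} {e : ℕ}
    (hm : (haveI := (h.isRegularLocalRing k).toIsLocalRing; maximalIdeal (R k)) = Ideal.span {t, q})
    (hθq : residueMap W (hall k hk) q = 0) (hθt : residueMap W (hall k hk) t ≠ 0) (heb : e < b)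
    (hJ : J k = Ideal.span {q ^ e * g}) :
    ∃ (ht1 : (t : F) ∈ R (k + 1)) (q' g' : R (k + 1)),
      (haveI := (h.isRegularLocalRing (k + 1)).toIsLocalRing; maximalIdeal (R (k + 1))) = Ideal.span {⟨t, ht1⟩, q'} ∧
      residueMap W (hall (k + 1) (hk.trans (Nat.le_succ k))) q' = 0 ∧
      J (k + 1) = Ideal.span {q' ^ e * g'} ∧
      Subring.inclusion (h.le_succ k) g = ⟨t, ht1⟩ ^ (b - e) * g' := by
  haveI := h.isRegularLocalRing k
  haveI := h.isRegularLocalRing (k + 1)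
  have hOW := h.le_of_forall_le hO hall
  have hdim := h.ringKrullDim_eq_two k
  have hdim₁ := h.ringKrullDim_eq_two (k + 1)
  have hst := h.along hO k
  obtain ⟨htp, hqp⟩ := prime_of_span_pair hdim hm
  have ht0 : (t : F) ≠ 0 := fun e => htp.ne_zero (Subtype.ext e)
  have hq0 : (q : F) ≠ 0 := fun e => hqp.ne_zero (Subtype.ext e)
  -- `t` is a unit of `W`, `q ∈ 𝔪_W`
  have htinv : (t : F)⁻¹ ∈ W.toSubring := (residueMap_ne_zero_iff W (hall k hk) ht0).mp hθt
  have hqm : Subring.inclusion (hall k hk) q ∈ maximalIdeal W.toSubring := (residueMap_eq_zero_iff W _ q).mp hθq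
  -- `ν(q/t) > 0`: else `t/q ∈ O ⊆ W` and `t = (t/q) q ∈ 𝔪_W`
  have hlt : O.valuation ((q : F) / (t : F)) < 1 := by
    by_contra hge
    push Not at hge
    have htq : (t : F) / (q : F) ∈ O := by
      rw [← O.valuation_le_one_iff, map_div₀, div_le_one₀ (pos_iff_ne_zero.mpr ((map_ne_zero _).mpr hq0))]
      rw [map_div₀, one_le_div₀ (pos_iff_ne_zero.mpr ((map_ne_zero _).mpr ht0))] at hge
      exact hge
    have htm : Subring.inclusion (hall k hk) t ∈ maximalIdeal W.toSubring := by
      have e1 : Subring.inclusion (hall k hk) t = ⟨(t : F) / q, hOW htq⟩ * Subring.inclusion (hall k hk) q :=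
        Subtype.ext (by change (t : F) = (t : F) / q * q; rw [div_mul_cancel₀ _ hq0])
      rw [e1]; exact Ideal.mul_mem_left _ _ hqm
    rcases (mem_maximalIdeal_iff_inv_not_mem _).mp htm with h0 | hni
    · exact ht0 h0
    · exact hni htinv
  -- `𝔪_{k+1} = (t, q/t)`
  obtain ⟨ht1, hqt1, hm₁⟩ := maximalIdeal_eq_span_pair hst (hO k) (hO (k + 1)) t.2 q.2 (by simpa using hm) ht0 hlt
  set T : R (k + 1) := ⟨(t : F), ht1⟩ with hT
  set Q : R (k + 1) := ⟨(q : F) / (t : F), hqt1⟩ with hQ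
  obtain ⟨hTp, hQp⟩ := prime_of_span_pair hdim₁ hm₁
  have hTQ : ¬ T ∣ Q := by
    intro hd
    apply maximalIdeal_ne_span_singleton hdim₁ T
    rw [hm₁]
    apply le_antisymm
    · rw [Ideal.span_le]
      intro z hz
      rcases hz with hz | hz
      · rw [hz]; exact Ideal.mem_span_singleton_self _
      · rw [Set.mem_singleton_iff] at hz; rw [hz]; exact Ideal.mem_span_singleton.mpr hd
    · exact Ideal.span_mono (Set.singleton_subset_iff.mpr (Set.mem_insert _ _))
  -- `𝔪_k R_{k+1} = (t)`
  have hincq : Subring.inclusion (h.le_succ k) q = T * Q :=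
    Subtype.ext (by change (q : F) = (t : F) * ((q : F) / (t : F)); rw [mul_div_cancel₀ _ ht0])
  have hmx : extIdeal (maximalIdeal (R k)) (R (k + 1)) = Ideal.span {T} := by
    rw [extIdeal_eq_map _ (h.le_succ k), hm, Ideal.map_span, Set.image_insert_eq, Set.image_singleton, hincq]
    apply le_antisymm
    · rw [Ideal.span_le]
      intro z hz
      rcases hz with hz | hz
      · rw [hz]; exact Ideal.mem_span_singleton_self _
      · rw [Set.mem_singleton_iff] at hz
        rw [hz]; exact Ideal.mul_mem_right _ _ (Ideal.mem_span_singleton_self _)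
    · exact Ideal.span_mono (Set.singleton_subset_iff.mpr (Set.mem_insert _ _))
  -- the transform law: `T^b J(k+1) = (T^e Q^e g)`
  have hprod := h.span_pow_mul_eq k ht1 hmx
  rw [hJ, extIdeal_eq_map _ (h.le_succ k), Ideal.map_span, Set.image_singleton, map_mul, map_pow, hincq] at hprod
  -- `T^{b-e} ∣ g`
  set G : R (k + 1) := Subring.inclusion (h.le_succ k) g with hG
  have hmem : (T * Q) ^ e * G ∈ Ideal.span {T ^ b} * J (k + 1) := by rw [hprod]; exact Ideal.mem_span_singleton_self _
  obtain ⟨j, -, hj⟩ := Ideal.mem_span_singleton_mul.mp hmem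
  have hdvd : T ^ (b - e) ∣ Q ^ e * G := by
    refine ⟨j, mul_left_cancel₀ (pow_ne_zero e hTp.ne_zero) ?_⟩
    rw [← mul_assoc, ← mul_pow, ← hj, ← mul_assoc, ← pow_add, Nat.add_sub_cancel' heb.le]
  have hTQe : ¬ T ∣ Q ^ e := fun hd => hTQ (hTp.dvd_of_dvd_pow hd)
  obtain ⟨g', hg'⟩ := hTp.pow_dvd_of_dvd_mul_left (b - e) hTQe hdvd
  refine ⟨ht1, Q, g', hm₁, ?_, ?_, hg'⟩
  · -- `θ(q/t) = 0`
    rw [residueMap_eq_zero_iff]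
    have e1 : Subring.inclusion (hall (k + 1) (hk.trans (Nat.le_succ k))) Q =
        Subring.inclusion (hall k hk) q * ⟨(t : F)⁻¹, htinv⟩ :=
      Subtype.ext (by change (q : F) / t = q * (t : F)⁻¹; rw [div_eq_mul_inv])
    rw [e1]; exact Ideal.mul_mem_right _ _ hqm
  · -- `J (k+1) = (Q^e g')`
    have hT0 : T ^ b ≠ 0 := pow_ne_zero b hTp.ne_zero
    apply (Ideal.span_singleton_mul_right_inj hT0).mp
    rw [hprod, Ideal.span_singleton_mul_span_singleton]
    have e1 : (T * Q) ^ e * G = T ^ b * (Q ^ e * g') := by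
      calc (T * Q) ^ e * G = (T ^ e * T ^ (b - e)) * (Q ^ e * g') := by rw [hg', mul_pow]; ring
        _ = T ^ b * (Q ^ e * g') := by rw [← pow_add, Nat.add_sub_cancel' heb.le]
    rw [e1]

end Descent

end IsThreadChain

namespace IsThreadChain

variable {b : ℕ} {R : ℕ → Subring F} {J : ∀ k, Ideal (R k)} (h : IsThreadChain b R J)
include h

section Final

variable {O : ValuationSubring F} (hO : ∀ k, SubringDominates (R k) O.toSubring) {W : LocalSubring F} {N : ℕ}
  (hall : ∀ k, N ≤ k → R k ≤ W.toSubring)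
include hO hall

/-- **Descent in the smooth regime**: the data `𝔪_k = (t, q)`, `θ(q) = 0`, `θ(t)` a uniformizer of the discrete
valuation ring `θ(O)`, `J k = (q^e g)`, `e < b`, `θ(g) ≠ 0` are impossible — `smooth_step` reproduces them at `k + 1`
with `θ(g) = θ(t)^{b-e} θ(g')`, so the valuation of `θ(g)` would decrease forever. [cite: ZariskiSamuel1960, Appendix 5] -/
theorem false_of_smooth_data (hdvr : IsDiscreteValuationRing (residueImage O W (h.le_of_forall_le hO hall))) :
    ∀ (n : ℕ) (k : ℕ) (hk : N ≤ k) (t q g : R k) (e : ℕ),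
      (haveI := (h.isRegularLocalRing k).toIsLocalRing; maximalIdeal (R k)) = Ideal.span {t, q} →
      residueMap W (hall k hk) q = 0 →
      Irreducible (⟨residueMap W (hall k hk) t, residueMap_mem_residueImage hO (h.le_of_forall_le hO hall) k t⟩ :
        residueImage O W (h.le_of_forall_le hO hall)) →
      e < b → J k = Ideal.span {q ^ e * g} → residueMap W (hall k hk) g ≠ 0 →
      IsDiscreteValuationRing.addVal (residueImage O W (h.le_of_forall_le hO hall))
        ⟨residueMap W (hall k hk) g, residueMap_mem_residueImage hO (h.le_of_forall_le hO hall) k g⟩ ≤ n → False := by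
  have hOW := h.le_of_forall_le hO hall
  haveI := hdvr
  intro n
  induction n with
  | zero => ?_
  | succ m ih => ?_
  all_goals
    intro k hk t q g e hm hθq hϖ heb hJ hθg hle
    have hθt : residueMap W (hall k hk) t ≠ 0 := fun e0 => hϖ.ne_zero (Subtype.ext e0)
    obtain ⟨ht1, q', g', hm₁, hθq', hJ₁, hgg'⟩ := h.smooth_step hO hall hk hm hθq hθt heb hJ
    have hk1 : N ≤ k + 1 := hk.trans (Nat.le_succ k)
    -- `θ(g) = θ(t)^{b-e} θ(g')` in `θ(O)`
    have hprod : (⟨residueMap W (hall k hk) g, residueMap_mem_residueImage hO hOW k g⟩ : residueImage O W hOW) =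
        (⟨residueMap W (hall (k + 1) hk1) ⟨(t : F), ht1⟩, residueMap_mem_residueImage hO hOW (k + 1) _⟩ :
          residueImage O W hOW) ^ (b - e) *
        ⟨residueMap W (hall (k + 1) hk1) g', residueMap_mem_residueImage hO hOW (k + 1) g'⟩ := by
      apply Subtype.ext
      change residueMap W (hall k hk) g = residueMap W (hall (k + 1) hk1) ⟨(t : F), ht1⟩ ^ (b - e) *
        residueMap W (hall (k + 1) hk1) g'
      rw [← map_pow, ← map_mul, ← hgg']
      rfl
    have htt : (⟨residueMap W (hall (k + 1) hk1) ⟨(t : F), ht1⟩, residueMap_mem_residueImage hO hOW (k + 1) _⟩ :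
        residueImage O W hOW) =
        ⟨residueMap W (hall k hk) t, residueMap_mem_residueImage hO hOW k t⟩ := Subtype.ext rfl
    have hθg' : residueMap W (hall (k + 1) hk1) g' ≠ 0 := by
      intro h0
      apply hθg
      have := congrArg Subtype.val hprod
      change residueMap W (hall k hk) g = residueMap W (hall (k + 1) hk1) ⟨(t : F), ht1⟩ ^ (b - e) *
        residueMap W (hall (k + 1) hk1) g' at this
      rw [this, h0, mul_zero]
    have hval : IsDiscreteValuationRing.addVal (residueImage O W hOW)
        ⟨residueMap W (hall k hk) g, residueMap_mem_residueImage hO hOW k g⟩ =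
        ((b - e : ℕ) : ℕ∞) + IsDiscreteValuationRing.addVal (residueImage O W hOW)
          ⟨residueMap W (hall (k + 1) hk1) g', residueMap_mem_residueImage hO hOW (k + 1) g'⟩ := by
      rw [hprod, IsDiscreteValuationRing.addVal_mul, IsDiscreteValuationRing.addVal_pow, htt,
        IsDiscreteValuationRing.addVal_uniformizer hϖ, nsmul_one]
    have hne : IsDiscreteValuationRing.addVal (residueImage O W hOW)
        ⟨residueMap W (hall (k + 1) hk1) g', residueMap_mem_residueImage hO hOW (k + 1) g'⟩ ≠ ⊤ := by
      rw [Ne, IsDiscreteValuationRing.addVal_eq_top_iff]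
      exact fun e0 => hθg' (congrArg Subtype.val e0)
    obtain ⟨m', hm'⟩ := ENat.ne_top_iff_exists.mp hne
    rw [hval, ← hm', ← Nat.cast_add, Nat.cast_le] at hle
  · omega
  · refine ih (k + 1) hk1 ⟨(t : F), ht1⟩ q' g' e hm₁ hθq' (htt ▸ hϖ) heb hJ₁ hθg' ?_
    rw [← hm', Nat.cast_le]
    omega

/-- **The followed-curve end game (abstract local subring).** A thread chain whose members from stage `N` on lie in a
local subring `W ⊆ F` consisting of fractions `a s⁻¹` (`a, s ∈ R N`, `s` a unit of `W`), containing the inverse of some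
non-unit of `R N` and missing the inverse of some non-zero element of `R N`, is impossible.
[cite: HerrmannIkedaOrbanz1988, Thm. (30.2) (proof)] -/
theorem false_of_forall_le_localSubring
    (hfrac : ∀ w ∈ W.toSubring, ∃ a ∈ R N, ∃ s ∈ R N, s ≠ 0 ∧ s⁻¹ ∈ W.toSubring ∧ w = a * s⁻¹)
    (hunit : ∃ z : R N, z ≠ 0 ∧ (z : F)⁻¹ ∉ R N ∧ (z : F)⁻¹ ∈ W.toSubring)
    (hnon : ∃ w : R N, w ≠ 0 ∧ (w : F)⁻¹ ∉ W.toSubring) : False := by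
  obtain ⟨hdvr, c, hc, t, q, g, e, hm, hθq, hϖ, heb, hJ, hθg⟩ := h.exists_smooth_data hO hall hfrac hunit hnon
  haveI := hdvr
  have hOW := h.le_of_forall_le hO hall
  have hne : IsDiscreteValuationRing.addVal (residueImage O W hOW)
      ⟨residueMap W (hall c hc) g, residueMap_mem_residueImage hO hOW c g⟩ ≠ ⊤ := by
    rw [Ne, IsDiscreteValuationRing.addVal_eq_top_iff]
    exact fun e0 => hθg (congrArg Subtype.val e0)
  obtain ⟨n, hn⟩ := ENat.ne_top_iff_exists.mp hne
  exact h.false_of_smooth_data hO hall hdvr n c hc t q g e hm hθq hϖ heb hJ hθg hn.symm.le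

end Final

/-- **The followed-curve end game.** No thread chain stays forever inside the prime divisor `(R N)_{(π)}` of a curve
through the point of stage `N` (`π` a prime element of `R N` generating a non-maximal prime).
[cite: HerrmannIkedaOrbanz1988, Thm. (30.2) (proof)] -/
theorem false_of_forall_le {N : ℕ} {π : R N} (hπ : Prime π)
    (hπm : Ideal.span {π} ≠ (haveI := (h.isRegularLocalRing N).toIsLocalRing; maximalIdeal (R N)))
    (hall : ∀ k, N ≤ k → haveI := isPrime_span_of_prime hπ;
      R k ≤ (LocalSubring.ofPrime (R N) (Ideal.span {π})).toSubring) : False := by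
  haveI := h.isRegularLocalRing N
  haveI := isPrime_span_of_prime hπ
  obtain ⟨O, hO⟩ := h.exists_valuationSubring
  have hπm' : π ∈ maximalIdeal (R N) := by
    rw [mem_maximalIdeal, mem_nonunits_iff]; exact hπ.not_unit
  obtain ⟨z, hzm, hzπ⟩ : ∃ z ∈ maximalIdeal (R N), z ∉ Ideal.span {π} := by
    by_contra hall'
    push Not at hall'
    exact hπm (le_antisymm ((Ideal.span_singleton_le_iff_mem _).mpr hπm') hall')
  have hz0 : z ≠ 0 := by rintro rfl; exact hzπ (Ideal.zero_mem _)
  refine h.false_of_forall_le_localSubring hO (W := LocalSubring.ofPrime (R N) (Ideal.span {π})) hall ?_ ?_ ?_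
  · intro w hw
    obtain ⟨a, s, hs, rfl⟩ := mem_ofPrime_iff.mp hw
    have hs0 : s ≠ 0 := by rintro rfl; exact hs (Ideal.zero_mem _)
    exact ⟨a, a.2, s, s.2, fun e => hs0 (Subtype.ext e), inv_mem_ofPrime hs, div_eq_mul_inv _ _⟩
  · refine ⟨z, hz0, ?_, ?_⟩
    · rcases (mem_maximalIdeal_iff_inv_not_mem z).mp hzm with h0 | hni
      · exact absurd (Subtype.ext h0) hz0
      · exact hni
    · by_contra hni
      exact hzπ (Ideal.mem_span_singleton.mpr ((not_inv_mem_ofPrime_span_iff_dvd hπ hz0).mp hni))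
  · exact ⟨π, hπ.ne_zero, inv_not_mem_ofPrime_span hπ⟩

end IsThreadChain

/-- **THE THREAD-CHAIN THEOREM.** [OURS · L1 W4.6 rung (i-a)] NOT a statement of the manuscript. There is no thread chain:
an infinite chain of quadratic transforms of two-dimensional regular local rings inside a field carrying ideals with the
transform law of `(J, b)`, singular at every stage, with isolated singular locus at every stage, is impossible — for every
`b`, every sequence of subrings `R` of a field and every sequence of ideals `J`, `¬ IsThreadChain b R J`. Either no curve is
followed forever (exceptional end game, `IsThreadChain.false_of_forall_exists_not_le`) or some curve is (followed-curve end
game, `IsThreadChain.false_of_forall_le`). [cite: ZariskiSamuel1960, Appendix 5] -/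
theorem not_isThreadChain (b : ℕ) (R : ℕ → Subring F) (J : ∀ k, Ideal (R k)) : ¬ IsThreadChain b R J := by
  intro h
  by_cases hNF : ∀ (N : ℕ) (π : R N) (hπ : Prime π), ∃ k, N ≤ k ∧
      ¬ (haveI := isPrime_span_of_prime hπ; R k ≤ (LocalSubring.ofPrime (R N) (Ideal.span {π})).toSubring)
  · exact h.false_of_forall_exists_not_le hNF
  · push Not at hNF
    obtain ⟨N, π, hπ, hall⟩ := hNF
    haveI := h.isRegularLocalRing N
    exact h.false_of_forall_le hπ (maximalIdeal_ne_span_singleton (h.ringKrullDim_eq_two N) π).symm hall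

end CampaignW46

end Summit.ResolutionOfSingularities.ResolutionOfSingularities.Theorems

end
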